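import Literature.Computability.Complexity.BrickAlgebra
import Literature.Computability.Complexity.StackBricksArith
import Literature.Computability.Complexity.StringEquality
import HarnessLib

/-!
# Integer bricks: signed integers as difference pairs of numerals, in the `FP` algebra

Trunk `CplxCore`, toolkit continuing `StackBricks.lean` / `StackBricksArith.lean` (the total
arithmetic bricks on numerals `addFn`, `prodFn`, `ltFn`, … with their `_boolPair` evaluation
rules) and `BrickAlgebra.lean` (records, `fanoutFn`, `iteFn`, counted loops). Verifiers of
arithmetic certificates (the `NP` verifier of `GapSVP`, `Algebra/EuclideanLattices/`) compute with
*signed* integers. Inside the `FP` algebra a signed integer is held SIGN-FREE as a **difference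
pair** `⟨P, Q⟩` of numerals (least significant bit first, read by the total `bitsToNat`), of value
`⟦P⟧ - ⟦Q⟧` — the representation of `StackInts.lean`, here at the level of total string functions:
every string denotes an integer (`ival`), so that specifications are total equations and a
verifier is automatically sound against malformed witnesses.

* `ival w = ⟦fstF w⟧ - ⟦sndF w⟧` (total), `dpEnc z` (the canonical pair `(z⁺, z⁻)`),
  `ival_dpEnc`; `smval e` — the value of a string read in the SIGN–MAGNITUDE format of
  `encodingIntBool` (`⟨[z < 0], |z|⟩`), `smval_encode`;
* `iaddFn ⟨u, v⟩`, `imulFn ⟨u, v⟩` — sum and product (`ival_iaddFn_boolPair`,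
  `ival_imulFn_boolPair`: `(a - b)(c - d) = (ac + bd) - (ad + bc)`, no case analysis), in `FP`,
  with linear length bounds (`length_iaddFn_boolPair_le`, `length_imulFn_boolPair_le`);
* `ofSMFn e` — conversion from sign–magnitude to a difference pair (`ival_ofSMFn = smval`), via
  the one-bit test `isTrue1Fn w = [w = [true]]`;
* `iposFn u = [0 < ival u]` — a one-bit sign test (`ltFn` on the swapped pair).

## References

* D. E. Knuth, *The Art of Computer Programming*, Vol. 2, 3rd ed., Addison-Wesley 1998, §4.3.1
  (multiple-precision arithmetic; signed numbers by magnitude comparison / difference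
  representation).
* S. Arora, B. Barak, *Computational Complexity: A Modern Approach*, CUP 2009, §1.3 (polynomial
  time is closed under composition).
-/

namespace Literature.Computability.Complexity

open _root_.Computability

namespace Brick

/-! ### Values -/

/-- The integer denoted by a string read as a difference pair: `⟦fstF w⟧ - ⟦sndF w⟧` (total; the
empty string denotes `0`). [cite: KnuthTAOCP2, §4.3.1] -/
def ival (w : List Bool) : ℤ := (bitsToNat (fstF w) : ℤ) - bitsToNat (sndF w)

/-- `ival ⟨a, b⟩ = ⟦a⟧ - ⟦b⟧`. [folklore] -/
@[simp] theorem ival_boolPair (a b : List Bool) : ival (boolPair a b) = (bitsToNat a : ℤ) - bitsToNat b := by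
  simp [ival, fstF, sndF]

/-- The empty string denotes `0`. [folklore] -/
@[simp] theorem ival_nil : ival [] = 0 := by
  simp [ival, fstF, sndF, boolUnpair]

/-- The canonical difference pair of an integer: `(z, 0)` for `z ≥ 0`, `(0, |z|)` for `z < 0`
(as canonical numerals). [cite: KnuthTAOCP2, §4.3.1] -/
def dpEnc (z : ℤ) : List Bool := boolPair (encodeNat z.toNat) (encodeNat (-z).toNat)

/-- `ival (dpEnc z) = z`. [folklore] -/
@[simp] theorem ival_dpEnc (z : ℤ) : ival (dpEnc z) = z := by
  rw [dpEnc, ival_boolPair, bitsToNat_encodeNat, bitsToNat_encodeNat]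
  omega

/-- Length of the canonical pair: `|dpEnc z| = 2 |encodeNat z⁺| + 2 + |encodeNat z⁻|`. [folklore] -/
theorem length_dpEnc (z : ℤ) :
    (dpEnc z).length = 2 * (encodeNat z.toNat).length + 2 + (encodeNat (-z).toNat).length := by
  rw [dpEnc, length_boolPair]

/-- `|dpEnc z| ≤ 3 · size |z| + 2`. [folklore] -/
theorem length_dpEnc_le (z : ℤ) : (dpEnc z).length ≤ 3 * z.natAbs.size + 2 := by
  rw [length_dpEnc, TM2Pass.length_encodeNat_eq_size, TM2Pass.length_encodeNat_eq_size]
  have h1 : z.toNat.size ≤ z.natAbs.size := Nat.size_le_size (by omega)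
  have h2 : (-z).toNat.size ≤ z.natAbs.size := Nat.size_le_size (by omega)
  omega

/-- The integer denoted by a string read in the sign–magnitude format of `encodingIntBool`
(`⟨[z < 0], encodeNat |z|⟩`): negative iff the first component is exactly `[true]`. [folklore] -/
def smval (e : List Bool) : ℤ := if fstF e = [true] then -(bitsToNat (sndF e) : ℤ) else bitsToNat (sndF e)

/-- `smval` reads integer codes correctly. [folklore] -/
@[simp] theorem smval_encode (z : ℤ) : smval (encodingIntBool.encode z) = z := by
  have h : encodingIntBool.encode z = boolPair [decide (z < 0)] (encodeNat z.natAbs) := rfl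
  rw [h, smval]
  simp only [fstF, sndF, boolUnpair_boolPair, bitsToNat_encodeNat]
  by_cases hz : z < 0
  · simp [hz, Int.ofNat_natAbs_of_nonpos hz.le]
  · simp [hz, Int.natAbs_of_nonneg (le_of_not_gt hz)]

/-! ### The one-bit test `w = [true]` and the conversion from sign–magnitude -/

/-- `isTrue1Fn w = [decide (w = [true])]` (string equality with the constant `[true]`).
[folklore] -/
noncomputable def isTrue1Fn : List Bool → List Bool := eqPairFn ∘ fanoutFn id fun _ => [true]

/-- Value of `isTrue1Fn` on every string. [folklore] -/
@[simp] theorem isTrue1Fn_apply (w : List Bool) : isTrue1Fn w = [decide (w = [true])] := by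
  simp [isTrue1Fn, eqPairFn_boolPair]

/-- `isTrue1Fn ∈ FP`. [cite: AroraBarak2009, §1.3] -/
theorem isTrue1Fn_mem_FP : isTrue1Fn ∈ FP :=
  comp_mem_FP eqPairFn_mem_FP (fanoutFn_mem_FP (show (id : List Bool → List Bool) ∈ FP from PolyTimeComputable.id _) (const_mem_FP _))

/-- `isTrue1Fn` is one-bit. [folklore] -/
theorem oneBit_isTrue1Fn : OneBit isTrue1Fn := fun w => ⟨_, isTrue1Fn_apply w⟩

/-- **Sign–magnitude to difference pair**: `⟨[true], m⟩ ↦ ⟨[], m⟩`, anything else `e ↦ ⟨sndF e, []⟩`.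
[cite: KnuthTAOCP2, §4.3.1] -/
noncomputable def ofSMFn : List Bool → List Bool :=
  iteFn (isTrue1Fn ∘ fstF) (fanoutFn (fun _ => []) sndF) (fanoutFn sndF fun _ => [])

/-- `ofSMFn ∈ FP`. [cite: AroraBarak2009, §1.3] -/
theorem ofSMFn_mem_FP : ofSMFn ∈ FP :=
  iteFn_mem_FP (comp_mem_FP isTrue1Fn_mem_FP fstF_mem_FP) (fanoutFn_mem_FP (const_mem_FP _) sndF_mem_FP)
    (fanoutFn_mem_FP sndF_mem_FP (const_mem_FP _))

/-- Value of `ofSMFn` on every string. [folklore] -/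
theorem ofSMFn_apply (e : List Bool) :
    ofSMFn e = if fstF e = [true] then boolPair [] (sndF e) else boolPair (sndF e) [] := by
  rw [ofSMFn, iteFn_of_oneBit (oneBit_isTrue1Fn.comp _)]
  simp only [Function.comp_apply, isTrue1Fn_apply, fanoutFn_apply]
  by_cases h : fstF e = [true] <;> simp [h]

/-- **`ofSMFn` preserves the value**: `ival (ofSMFn e) = smval e` on every string. [folklore] -/
@[simp] theorem ival_ofSMFn (e : List Bool) : ival (ofSMFn e) = smval e := by
  rw [ofSMFn_apply, smval]
  split_ifs <;> simp

/-- `|ofSMFn e| ≤ 2 |e| + 2`. [folklore] -/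
theorem length_ofSMFn_le (e : List Bool) : (ofSMFn e).length ≤ 2 * e.length + 2 := by
  have h := length_fstF_sndF_le e
  rw [ofSMFn_apply]
  split_ifs <;> simp <;> omega

/-! ### Addition -/

/-- **Sum of difference pairs**: `⟨⟨P, Q⟩, ⟨P', Q'⟩⟩ ↦ ⟨P + P', Q + Q'⟩` (canonical numerals).
[cite: KnuthTAOCP2, §4.3.1] -/
noncomputable def iaddFn : List Bool → List Bool :=
  fanoutFn (addFn ∘ fanoutFn (fstF ∘ fstF) (fstF ∘ sndF)) (addFn ∘ fanoutFn (sndF ∘ fstF) (sndF ∘ sndF))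

/-- `iaddFn ∈ FP`. [cite: AroraBarak2009, §1.3] -/
theorem iaddFn_mem_FP : iaddFn ∈ FP :=
  fanoutFn_mem_FP (comp_mem_FP addFn_mem_FP (fanoutFn_mem_FP (comp_mem_FP fstF_mem_FP fstF_mem_FP)
      (comp_mem_FP fstF_mem_FP sndF_mem_FP)))
    (comp_mem_FP addFn_mem_FP (fanoutFn_mem_FP (comp_mem_FP sndF_mem_FP fstF_mem_FP)
      (comp_mem_FP sndF_mem_FP sndF_mem_FP)))

/-- Value of `iaddFn` on a pair. [folklore] -/
theorem iaddFn_boolPair (u v : List Bool) :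
    iaddFn (boolPair u v) = boolPair (encodeNat (bitsToNat (fstF u) + bitsToNat (fstF v)))
      (encodeNat (bitsToNat (sndF u) + bitsToNat (sndF v))) := by
  simp [iaddFn, fstF, sndF]

/-- **`iaddFn` adds**: `ival (iaddFn ⟨u, v⟩) = ival u + ival v` on every pair. [cite: KnuthTAOCP2, §4.3.1] -/
@[simp] theorem ival_iaddFn_boolPair (u v : List Bool) : ival (iaddFn (boolPair u v)) = ival u + ival v := by
  rw [iaddFn_boolPair, ival_boolPair, bitsToNat_encodeNat, bitsToNat_encodeNat, ival, ival]
  push_cast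
  ring

/-- Size of a sum of two numerals' values: `|encodeNat (⟦a⟧ + ⟦b⟧)| ≤ max |a| |b| + 1`. [folklore] -/
theorem length_encodeNat_add_le_max (a b : List Bool) :
    (encodeNat (bitsToNat a + bitsToNat b)).length ≤ max a.length b.length + 1 := by
  rw [TM2Pass.length_encodeNat_eq_size, Nat.size_le]
  have ha := bitsToNat_lt a
  have hb := bitsToNat_lt b
  have h1 : 2 ^ a.length ≤ 2 ^ max a.length b.length := Nat.pow_le_pow_right (by norm_num) (le_max_left _ _)
  have h2 : 2 ^ b.length ≤ 2 ^ max a.length b.length := Nat.pow_le_pow_right (by norm_num) (le_max_right _ _)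
  rw [pow_succ]
  omega

/-- **`iaddFn` is short**: `|iaddFn ⟨u, v⟩| ≤ |u| + |v| + 5`. [folklore] -/
theorem length_iaddFn_boolPair_le (u v : List Bool) : (iaddFn (boolPair u v)).length ≤ u.length + v.length + 5 := by
  rw [iaddFn_boolPair, length_boolPair]
  have h1 := length_encodeNat_add_le_max (fstF u) (fstF v)
  have h2 := length_encodeNat_add_le_max (sndF u) (sndF v)
  have hu := length_fstF_sndF_le u
  have hv := length_fstF_sndF_le v
  have hm1 : max (fstF u).length (fstF v).length ≤ (fstF u).length + (fstF v).length := max_le (by omega) (by omega)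
  have hm2 : max (sndF u).length (sndF v).length ≤ (sndF u).length + (sndF v).length := max_le (by omega) (by omega)
  omega

/-! ### Multiplication -/

/-- The four partial products of `⟨⟨P, Q⟩, ⟨P', Q'⟩⟩`: `PP'`, `QQ'`, `PQ'`, `QP'`. [folklore] -/
noncomputable def ppFn (f g : List Bool → List Bool) : List Bool → List Bool := prodFn ∘ fanoutFn (f ∘ fstF) (g ∘ sndF)

/-- `ppFn f g ∈ FP` for projections `f, g ∈ FP`. [folklore] -/
theorem ppFn_mem_FP {f g : List Bool → List Bool} (hf : f ∈ FP) (hg : g ∈ FP) : ppFn f g ∈ FP :=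
  comp_mem_FP prodFn_mem_FP (fanoutFn_mem_FP (comp_mem_FP hf fstF_mem_FP) (comp_mem_FP hg sndF_mem_FP))

/-- Value of a partial product on a pair. [folklore] -/
@[simp] theorem ppFn_boolPair (f g : List Bool → List Bool) (u v : List Bool) :
    ppFn f g (boolPair u v) = encodeNat (bitsToNat (f u) * bitsToNat (g v)) := by
  simp [ppFn, fstF, sndF]

/-- **Product of difference pairs**: `⟨⟨P, Q⟩, ⟨P', Q'⟩⟩ ↦ ⟨PP' + QQ', PQ' + QP'⟩`.
[cite: KnuthTAOCP2, §4.3.1] -/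
noncomputable def imulFn : List Bool → List Bool :=
  fanoutFn (addFn ∘ fanoutFn (ppFn fstF fstF) (ppFn sndF sndF)) (addFn ∘ fanoutFn (ppFn fstF sndF) (ppFn sndF fstF))

/-- `imulFn ∈ FP`. [cite: AroraBarak2009, §1.3] -/
theorem imulFn_mem_FP : imulFn ∈ FP :=
  fanoutFn_mem_FP
    (comp_mem_FP addFn_mem_FP (fanoutFn_mem_FP (ppFn_mem_FP fstF_mem_FP fstF_mem_FP) (ppFn_mem_FP sndF_mem_FP sndF_mem_FP)))
    (comp_mem_FP addFn_mem_FP (fanoutFn_mem_FP (ppFn_mem_FP fstF_mem_FP sndF_mem_FP) (ppFn_mem_FP sndF_mem_FP fstF_mem_FP)))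

/-- Value of `imulFn` on a pair. [folklore] -/
theorem imulFn_boolPair (u v : List Bool) :
    imulFn (boolPair u v) =
      boolPair (encodeNat (bitsToNat (fstF u) * bitsToNat (fstF v) + bitsToNat (sndF u) * bitsToNat (sndF v)))
        (encodeNat (bitsToNat (fstF u) * bitsToNat (sndF v) + bitsToNat (sndF u) * bitsToNat (fstF v))) := by
  simp [imulFn]

/-- **`imulFn` multiplies**: `ival (imulFn ⟨u, v⟩) = ival u · ival v` on every pair. [cite: KnuthTAOCP2, §4.3.1] -/
@[simp] theorem ival_imulFn_boolPair (u v : List Bool) : ival (imulFn (boolPair u v)) = ival u * ival v := by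
  rw [imulFn_boolPair, ival_boolPair, bitsToNat_encodeNat, bitsToNat_encodeNat, ival, ival]
  push_cast
  ring

/-- Size of a sum of two products of numerals' values. [folklore] -/
theorem length_encodeNat_mul_add_mul_le (a b c d : List Bool) :
    (encodeNat (bitsToNat a * bitsToNat b + bitsToNat c * bitsToNat d)).length ≤
      max (a.length + b.length) (c.length + d.length) + 1 := by
  rw [TM2Pass.length_encodeNat_eq_size, Nat.size_le]
  have ha := bitsToNat_lt a
  have hb := bitsToNat_lt b
  have hc := bitsToNat_lt c
  have hd := bitsToNat_lt d
  have h1 : bitsToNat a * bitsToNat b < 2 ^ (a.length + b.length) := by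
    rw [pow_add]; exact Nat.mul_lt_mul'' ha hb
  have h2 : bitsToNat c * bitsToNat d < 2 ^ (c.length + d.length) := by
    rw [pow_add]; exact Nat.mul_lt_mul'' hc hd
  have h3 : 2 ^ (a.length + b.length) ≤ 2 ^ max (a.length + b.length) (c.length + d.length) :=
    Nat.pow_le_pow_right (by norm_num) (le_max_left _ _)
  have h4 : 2 ^ (c.length + d.length) ≤ 2 ^ max (a.length + b.length) (c.length + d.length) :=
    Nat.pow_le_pow_right (by norm_num) (le_max_right _ _)
  rw [pow_succ]
  omega

/-- **`imulFn` is short**: `|imulFn ⟨u, v⟩| ≤ 3 (|u| + |v|) + 5`. [folklore] -/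
theorem length_imulFn_boolPair_le (u v : List Bool) :
    (imulFn (boolPair u v)).length ≤ 3 * (u.length + v.length) + 5 := by
  rw [imulFn_boolPair, length_boolPair]
  have h1 := length_encodeNat_mul_add_mul_le (fstF u) (fstF v) (sndF u) (sndF v)
  have h2 := length_encodeNat_mul_add_mul_le (fstF u) (sndF v) (sndF u) (fstF v)
  have hu := length_fstF_sndF_le u
  have hv := length_fstF_sndF_le v
  have hm1 : max ((fstF u).length + (fstF v).length) ((sndF u).length + (sndF v).length) ≤ u.length + v.length :=
    max_le (by omega) (by omega)
  have hm2 : max ((fstF u).length + (sndF v).length) ((sndF u).length + (fstF v).length) ≤ u.length + v.length :=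
    max_le (by omega) (by omega)
  omega

/-! ### Sign test -/

/-- **Positivity test**: `iposFn u = [decide (0 < ival u)]` (`⟦sndF u⟧ < ⟦fstF u⟧`), one-bit.
[folklore] -/
noncomputable def iposFn : List Bool → List Bool := ltFn ∘ fanoutFn sndF fstF

/-- `iposFn ∈ FP`. [cite: AroraBarak2009, §1.3] -/
theorem iposFn_mem_FP : iposFn ∈ FP := comp_mem_FP ltFn_mem_FP (fanoutFn_mem_FP sndF_mem_FP fstF_mem_FP)

/-- Value of `iposFn` on every string. [folklore] -/
@[simp] theorem iposFn_apply (u : List Bool) : iposFn u = [decide (0 < ival u)] := by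
  simp only [iposFn, Function.comp_apply, fanoutFn_apply, ltFn_boolPair, ival, sub_pos, Nat.cast_lt]

/-- `iposFn` is one-bit. [folklore] -/
theorem oneBit_iposFn : OneBit iposFn := fun u => ⟨_, iposFn_apply u⟩

end Brick

end Literature.Computability.Complexity
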